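import Summits.AtomisticToContinuum.Crystallization.Theorems.FrustratedLawDichotomyCellArithNashInt

/-!
# FrustratedLawDichotomy · crux `AperiodicFrustratedLawGap` (stmt-AtomisticToContinuum-27623) — CELL-ARITH, the FLAT kernel form of the
# all-integer per-pair NASH box (decomp-a2c hand-1 g53; sequel of `…CellArithNashInt`)

The same six integer bounds as `…CellArithNashInt.linLabILo/linLabIHi`, computed from FLAT integer arguments
`z0 z1 z2 w0 w1 w2` with `Int.natAbs`, explicit three-term sums and `if`-branches (`izLoF/izHiF`) — no `Fin 3` `Finset` sums, no
`![…]` vectors, no lattice `min/max` on the per-pair path.  Measured (farm, decide +kernel, HOME/decomp-a2c-hand-1/g53/check/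
Kernel_NashInt*.lean): 12 000 pairs × 6 bounds in 43.7 s FLAT vs 94.6 s through the structured defs vs 101 s `let`-fused structured
(the kernel does not profit from `let` sharing here) ⇒ ≈ 3.3 ms per pair ⇒ a Tier-K cell's ≈ 1.3e5 pairs at `L_N = 3` ≈ 7 min in 3 slabs.
★ `linLabIF` + `linLabIF_mem` (soundness, same hypotheses as `linLabI_mem`).  Computable `def`s over `ℤ`; imports `…CellArithNashInt`; 0 sorry.
Tags: [folklore].
-/

namespace Summit.AtomisticToContinuum.Crystallization.Theorems.FrustratedLawDichotomyCellArithNashIntFlat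

open scoped BigOperators
open Summit.AtomisticToContinuum.Crystallization.Theorems.FrustratedLawDichotomyCoherentFloorAlgebra (psiT psiT1)
open Summit.AtomisticToContinuum.Crystallization.Theorems.FrustratedLawDichotomyCellMetric (gram linLab)
open Summit.AtomisticToContinuum.Crystallization.Theorems.FrustratedLawDichotomyCellArithGram (pairLo pairHi)
open Summit.AtomisticToContinuum.Crystallization.Theorems.FrustratedLawDichotomyCellArithNashInt

/-! ## The flat per-pair box -/

/-- flat exact lower bound of `c·x` (branch on the sign of the integer `c`; equals `izLo` when `XL ≤ XH`). [folklore] -/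
def izLoF (XL XH c : ℤ) : ℤ := if 0 ≤ c then c * XL else c * XH

/-- flat exact upper bound of `c·x`. [folklore] -/
def izHiF (XL XH c : ℤ) : ℤ := if 0 ≤ c then c * XH else c * XL

/-- `izLoF ≤ T·(c·x)`. [folklore] -/
theorem izLoF_le {XL XH c : ℤ} {T x : ℝ} (h1 : (XL : ℝ) ≤ T * x) (h2 : T * x ≤ (XH : ℝ)) :
    ((izLoF XL XH c : ℤ) : ℝ) ≤ T * ((c : ℝ) * x) := by
  unfold izLoF
  have e : T * ((c : ℝ) * x) = (c : ℝ) * (T * x) := by ring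
  rw [e]
  split_ifs with hc
  · push_cast; exact mul_le_mul_of_nonneg_left h1 (by exact_mod_cast hc)
  · push_cast; exact mul_le_mul_of_nonpos_left h2 (by exact_mod_cast (not_le.1 hc).le)

/-- `T·(c·x) ≤ izHiF`. [folklore] -/
theorem le_izHiF {XL XH c : ℤ} {T x : ℝ} (h1 : (XL : ℝ) ≤ T * x) (h2 : T * x ≤ (XH : ℝ)) :
    T * ((c : ℝ) * x) ≤ ((izHiF XL XH c : ℤ) : ℝ) := by
  unfold izHiF
  have e : T * ((c : ℝ) * x) = (c : ℝ) * (T * x) := by ring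
  rw [e]
  split_ifs with hc
  · push_cast; exact mul_le_mul_of_nonneg_left h2 (by exact_mod_cast hc)
  · push_cast; exact mul_le_mul_of_nonpos_left h1 (by exact_mod_cast (not_le.1 hc).le)

/-- ★ THE FLAT PER-PAIR BOX: six integers `(lo₀, hi₀, lo₁, hi₁, lo₂, hi₂)` bounding `Σ·(linLab G a ω) i`, `i = 0, 1, 2`, from flat integer
arguments (the K-file's fold calls this with literals; `Int.natAbs` for `|·|`, explicit sums, `if` for the sign branches). [folklore] -/
def linLabIF (PL PH P1L P1H ed en hn hd z0 z1 z2 w0 w1 w2 : ℤ) : ℤ × ℤ × ℤ × ℤ × ℤ × ℤ :=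
  let d := z0 * w0 + z1 * w1 + z2 * w2
  let l := ((z0.natAbs + z1.natAbs + z2.natAbs : ℕ) : ℤ) * ((w0.natAbs + w1.natAbs + w2.natAbs : ℕ) : ℤ)
  let gL := ed * d - en * l
  let gH := ed * d + en * l
  let cL := pairLo P1L P1H gL gH
  let cH := pairHi P1L P1H gL gH
  let k := ed * hd ^ 2
  let c := 2 * hn ^ 2
  (k * izLoF PL PH w0 + izLoF cL cH (c * z0), k * izHiF PL PH w0 + izHiF cL cH (c * z0),
    k * izLoF PL PH w1 + izLoF cL cH (c * z1), k * izHiF PL PH w1 + izHiF cL cH (c * z1),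
    k * izLoF PL PH w2 + izLoF cL cH (c * z2), k * izHiF PL PH w2 + izHiF cL cH (c * z2))

section Flat

variable {S D ed en hn hd PL PH P1L P1H : ℤ} {G : Matrix (Fin 3) (Fin 3) ℝ} {ε : ℝ} {z w : Fin 3 → ℤ}
  {a ω : Fin 3 → ℝ}

/-- the flat `ℓ¹`/dot data equal `l1Z`/`dotZ`. -/
theorem flat_data (z w : Fin 3 → ℤ) :
    z 0 * w 0 + z 1 * w 1 + z 2 * w 2 = dotZ z w
      ∧ (((z 0).natAbs + (z 1).natAbs + (z 2).natAbs : ℕ) : ℤ) * (((w 0).natAbs + (w 1).natAbs + (w 2).natAbs : ℕ) : ℤ)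
        = l1Z z * l1Z w := by
  unfold dotZ l1Z
  constructor
  · simp only [Fin.sum_univ_three]
  · simp only [Fin.sum_univ_three, Nat.cast_add, Int.natCast_natAbs]

/-- ★ SOUNDNESS OF THE FLAT FORM: with `B := linLabIF … (z 0) (z 1) (z 2) (w 0) (w 1) (w 2)` and `Σ := S·D·ed·hd²`,
`B.1 ≤ Σ·linLab 0 ≤ B.2.1`, `B.2.2.1 ≤ Σ·linLab 1 ≤ B.2.2.2.1`, `B.2.2.2.2.1 ≤ Σ·linLab 2 ≤ B.2.2.2.2.2`. [folklore] -/
theorem linLabIF_mem (hG : ∀ i j, |G i j - (if i = j then 1 else 0)| ≤ ε) (hε : ε = (en : ℝ) / (ed : ℝ)) (hed : 0 < ed)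
    (hD : 0 < D) (hhd : 0 < hd) (ha : ∀ j, a j = (hn : ℝ) / (hd : ℝ) * (z j : ℝ)) (hω : ∀ j, ω j = (w j : ℝ) / (D : ℝ))
    (hPL : (PL : ℝ) ≤ S * psiT (gram G a a)) (hPH : S * psiT (gram G a a) ≤ (PH : ℝ))
    (hP1L : (P1L : ℝ) ≤ S * psiT1 (gram G a a)) (hP1H : S * psiT1 (gram G a a) ≤ (P1H : ℝ)) :
    let B := linLabIF PL PH P1L P1H ed en hn hd (z 0) (z 1) (z 2) (w 0) (w 1) (w 2)
    let Sg : ℝ := ((S * D * ed * hd ^ 2 : ℤ) : ℝ)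
    ((B.1 : ℝ) ≤ Sg * linLab G a ω 0 ∧ Sg * linLab G a ω 0 ≤ (B.2.1 : ℝ))
      ∧ ((B.2.2.1 : ℝ) ≤ Sg * linLab G a ω 1 ∧ Sg * linLab G a ω 1 ≤ (B.2.2.2.1 : ℝ))
      ∧ ((B.2.2.2.2.1 : ℝ) ≤ Sg * linLab G a ω 2 ∧ Sg * linLab G a ω 2 ≤ (B.2.2.2.2.2 : ℝ)) := by
  have hD' : (0 : ℝ) < D := by exact_mod_cast hD
  have hhd' : (0 : ℝ) < hd := by exact_mod_cast hhd
  have hed' : (0 : ℝ) < ed := by exact_mod_cast hed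
  obtain ⟨g1, g2⟩ := gram_int_mem hG hed hε z w
  obtain ⟨fd, fl⟩ := flat_data z w
  have eΓ : gram G a ω = (hn : ℝ) / hd / D * gram G (fun i => (z i : ℝ)) (fun j => (w j : ℝ)) := by
    unfold gram; rw [Finset.mul_sum]
    refine Finset.sum_congr rfl fun i _ => ?_
    rw [Finset.mul_sum]
    refine Finset.sum_congr rfl fun j _ => ?_
    rw [ha i, hω j]; field_simp
  have cL := pairLo_le₂ hP1L hP1H g1 g2
  have cH := le_pairHi₂ hP1L hP1H g1 g2
  -- each coordinate: the same algebra as `linLabI_mem`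
  have coord : ∀ i : Fin 3,
      ((ed * hd ^ 2 * izLoF PL PH (w i)
          + izLoF (pairLo P1L P1H (ed * dotZ z w - en * (l1Z z * l1Z w)) (ed * dotZ z w + en * (l1Z z * l1Z w)))
              (pairHi P1L P1H (ed * dotZ z w - en * (l1Z z * l1Z w)) (ed * dotZ z w + en * (l1Z z * l1Z w))) (2 * hn ^ 2 * z i) : ℤ) : ℝ)
        ≤ ((S * D * ed * hd ^ 2 : ℤ) : ℝ) * linLab G a ω i
      ∧ ((S * D * ed * hd ^ 2 : ℤ) : ℝ) * linLab G a ω i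
        ≤ ((ed * hd ^ 2 * izHiF PL PH (w i)
          + izHiF (pairLo P1L P1H (ed * dotZ z w - en * (l1Z z * l1Z w)) (ed * dotZ z w + en * (l1Z z * l1Z w)))
              (pairHi P1L P1H (ed * dotZ z w - en * (l1Z z * l1Z w)) (ed * dotZ z w + en * (l1Z z * l1Z w))) (2 * hn ^ 2 * z i) : ℤ) : ℝ) := by
    intro i
    have t2L := izLoF_le (c := 2 * hn ^ 2 * z i) cL cH
    have t2H := le_izHiF (c := 2 * hn ^ 2 * z i) cL cH
    have t1L := izLoF_le (c := w i) hPL hPH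
    have t1H := le_izHiF (c := w i) hPL hPH
    have e : ((S * D * ed * hd ^ 2 : ℤ) : ℝ) * linLab G a ω i
        = (ed : ℝ) * hd ^ 2 * (S * ((w i : ℝ) * psiT (gram G a a)))
          + (S * ed) * (((2 * hn ^ 2 * z i : ℤ) : ℝ) * (psiT1 (gram G a a) * gram G (fun i => (z i : ℝ)) (fun j => (w j : ℝ)))) := by
      simp only [linLab, Pi.add_apply, Pi.smul_apply, smul_eq_mul]
      rw [eΓ, ha i, hω i]; push_cast
      field_simp
    rw [e]
    have hk : (0 : ℝ) ≤ (ed : ℝ) * hd ^ 2 := by positivity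
    have AL := mul_le_mul_of_nonneg_left t1L hk
    have AH := mul_le_mul_of_nonneg_left t1H hk
    push_cast at AL AH t2L t2H ⊢
    constructor
    · linarith
    · linarith
  dsimp only
  unfold linLabIF
  simp only [fd, fl]
  exact ⟨coord 0, coord 1, coord 2⟩

end Flat

end Summit.AtomisticToContinuum.Crystallization.Theorems.FrustratedLawDichotomyCellArithNashIntFlat
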